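import Summits.Ventures.HSemireg.WeilFrameRealCarrierDegrees
import Summits.Ventures.HSemireg.Mod4IdealShapePinZero
import Summits.Ventures.HSemireg.Mod4IdealShapeHankelRank

/-!
# Venture HSemireg — TABLE R's «1 − ch(O_Z)» (I_Z-SHAPE) ROW ON THE REAL CARRIER AT THE EXTREME PIN `t = q_n²` of an EVEN `n`:
# the middle entry is the `O_Z` value minus the `O_Z` drop-2 bit `[det B_0 = 0]` minus `dim ker(T_f + q_n)`, with `r_n` read off the Hankel square

HONEST FRAMING. Part of the Lean index of the computation cell `pub-hsemireg` (seat w3-mod4-1 gen 15, W3 SPECIAL FIBRES;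
MOD4-OFFSPLIT §13.33–13.34). The tree's real carriers and the Literature's Weil-type layer ONLY: no semiregularity map, no Ext
group, no `∫`; nothing here says that HC / HC_CM / HC_AV holds; nothing here is a claim about any explicit variety or cycle; no
Literature fact is declared; NO definition is introduced. Imports: FILE 13 `WeilFrameRealCarrierDegrees` (built) + the pure matrix
files `Mod4IdealShapePinZero` (FILE 56) and `Mod4IdealShapeHankelRank` (FILE 57).

WHAT IS PROVED, for `A : AbelianVariety ℂ` of dimension `2n`, `n` EVEN, `1 ≤ n`, with the Weil-type hypotheses of
`finrank_S_weilType_middle`, the class `x = Σ_{m ≤ 2n} (q_m/m!) ĥ^m + ĉ₊ + ĉ₋` of `I_Z` SHAPE (`q_0 ≠ 0`, `q_m = 0` for `1 ≤ m < n`,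
`q_n ≠ 0`, ANY tail), the pin `(2n)!·(ĉ₊ĉ₋) = t·ĥ^{2n}` with `t = q_n²` (the extreme `O_Z` pin), `B_0` the `n × n` pin block of
`T_f(q⁰) − q_n` (`q⁰ = q[0 ↦ 0]`), `Hsq = (q_{i+j})_{i,j ≤ n}`, and `f := dim ker(T_f(q) + q_n)` (the «second bit», `≤ 1` by
`Mod4IdealShapePinZero`, `= 0` iff `Π_b((−1)^bC(n,b)q_n + q_n) + (−1)ⁿq_0·det B⁻ ≠ 0` by `Mod4IdealShapeDet`):
* **`finrank_S_idealShape_middle_pinZero_of_det_eq_zero`** — `det Hsq ≠ 0`, `det B_0 = 0` ⇒ `dim S_n(x) + 2(n+1) + 1 + f = (n+3)·C(2n,n)`;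
* **`finrank_S_idealShape_middle_pinZero_of_det_ne_zero`** — `det Hsq ≠ 0`, `det B_0 ≠ 0` ⇒ `dim S_n(x) + 2(n+1) + f = (n+3)·C(2n,n)`;
* **`finrank_S_idealShape_middle_pinZero_hankelDeg_of_det_eq_zero`** — `det Hsq = 0`, `det B_0 = 0` ⇒ `dim S_n(x) + 2n + 1 + f = (n+2)·C(2n,n)`;
* **`finrank_S_idealShape_middle_pinZero_hankelDeg_of_det_ne_zero`** — `det Hsq = 0`, `det B_0 ≠ 0` ⇒ `dim S_n(x) + 2n + f = (n+2)·C(2n,n)`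
(`r_n` by `Mod4IdealShapeHankelRank`; the kernel dimension `[det B_0 = 0] + f` by `Mod4IdealShapePinZero`). READING: with a regular Hankel
square the `I_Z` row's middle entry at `q_n²` is the GENERIC `O_Z` value `(n+3)C(2n,n) − 2(n+1)` minus `[det B_0 = 0]` minus `f`
(`n = 2`: `24 ∕ 23 ∕ 22`; `n = 4`: `480 ∕ 479 ∕ 478` — the first drop on `3q₂q₄ = 2q₃²` resp. the weight-20 quartic).
Everything PROVED, 0 sorry.
References: [BuchweitzFlenner2008HH] Prop. 6.4.4; [vanGeemen1994HodgeAV] 4.9, Lemma 5.2; [BourbakiAlgebre1a3] Ch. III §8, §11 no. 9.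
-/

noncomputable section

open CliffordAlgebra (contractLeft)
open ExteriorAlgebra (ι)
open Module CategoryTheory
open Literature.AlgebraicGeometry.Motives Literature.AlgebraicGeometry.HodgeTheory
open Literature.AlgebraicTopology.SingularHomology

namespace Summit.Ventures.HSemireg.WeilFrame

open Summit.Ventures.HSemireg.WedgeBridge Summit.Ventures.HSemireg.WeilCarrier Summit.Ventures.HSemireg.Mod4Carrier
open Summit.Ventures.HSemireg.Wedge.Hankel

section RealCarrier

variable {A : AbelianVariety ℂ}

/-- **`I_Z` row, extreme pin, regular Hankel square, DEGENERATE `O_Z` tail** (`det Hsq ≠ 0`, `det B_0 = 0`):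
`dim S_n(x) + 2(n+1) + 1 + dim ker(T_f + q_n) = (n+3)·C(2n,n)`. [cite: BuchweitzFlenner2008HH, Prop. 6.4.4] [cite: vanGeemen1994HodgeAV, 4.9 and Lemma 5.2] -/
theorem finrank_S_idealShape_middle_pinZero_of_det_eq_zero (hA : IsSmoothProjective A.dim A.X) {n d : ℕ} (hn : 1 ≤ n) (heven : Even n)
    (hdim : A.dim = n + n) (hd : 0 < d)
    {φ : A ⟶ A} (hφ : φ ≫ φ = -(d • 𝟙 A)) {P Q : Submodule ℂ (complexBetti A.X 1)}
    (hP : P = Module.End.eigenspace (complexBetti.map φ.hom.hom.hom 1).hom (Complex.I * (Real.sqrt d : ℂ)))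
    (hQ : Q = Module.End.eigenspace (complexBetti.map φ.hom.hom.hom 1).hom (-(Complex.I * (Real.sqrt d : ℂ))))
    (hp : finrank ℂ ↥(P ⊓ hodgeOneZero hA) = n) {h : complexBetti A.X 2}
    (hh : complexBetti.map φ.hom.hom.hom 2 h = (d : ℂ) • h) (h11 : IsOfHodgeType A.dim A.X 2 1 1 h)
    (hvol : ((⋀[ℂ]^2 (complexBetti A.X 1)).subtype ((abelianVarietyCohomologyExteriorH1_holds.equiv A 2).symm h)) ^ (n + n) ≠ 0)
    {cP cQ : complexBetti A.X (2 * n)} (hcP : cP ∈ weilClassesPlus A φ n d) (hcP0 : cP ≠ 0)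
    (hcQ : cQ ∈ weilClassesMinus A φ n d) (hcQ0 : cQ ≠ 0)
    {q : ℕ → ℂ} (hq : ∀ m, 1 ≤ m → m < n → q m = 0) (hq0 : q 0 ≠ 0) (hqn : q n ≠ 0) {t : ℂ}
    (ht : (((n + n).factorial : ℕ) : ℂ) •
        ((⋀[ℂ]^(2 * n) (complexBetti A.X 1)).subtype ((abelianVarietyCohomologyExteriorH1_holds.equiv A (2 * n)).symm cP) *
          (⋀[ℂ]^(2 * n) (complexBetti A.X 1)).subtype ((abelianVarietyCohomologyExteriorH1_holds.equiv A (2 * n)).symm cQ)) =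
      t • ((⋀[ℂ]^2 (complexBetti A.X 1)).subtype ((abelianVarietyCohomologyExteriorH1_holds.equiv A 2).symm h)) ^ (n + n))
    (hpin : t = q n * q n) {B : Matrix (Fin n) (Fin n) ℂ}
    (hB : B = Matrix.of fun r s : Fin n =>
      (Mod4.hankelT n (Function.update q 0 0) - q n • (1 : Matrix (Fin (n + 1)) (Fin (n + 1)) ℂ)) ⟨0 + r, by omega⟩
        ⟨0 + 1 + s, by omega⟩)
    {Hsq : Matrix (Fin (n + 1)) (Fin (n + 1)) ℂ} (hHsq : Hsq = Matrix.of fun i j : Fin (n + 1) => q ((i : ℕ) + (j : ℕ)))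
    (hH : Hsq.det ≠ 0) (hdet : B.det = 0) :
    finrank ℂ ↥(S ℂ (hodgeZeroOne hA) n
        ((∑ m ∈ Finset.range (n + n + 1), (q m * ((m.factorial : ℕ) : ℂ)⁻¹) •
            ((⋀[ℂ]^2 (complexBetti A.X 1)).subtype ((abelianVarietyCohomologyExteriorH1_holds.equiv A 2).symm h)) ^ m) +
          (⋀[ℂ]^(2 * n) (complexBetti A.X 1)).subtype ((abelianVarietyCohomologyExteriorH1_holds.equiv A (2 * n)).symm cP) +
          (⋀[ℂ]^(2 * n) (complexBetti A.X 1)).subtype ((abelianVarietyCohomologyExteriorH1_holds.equiv A (2 * n)).symm cQ))) +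
        2 * (n + 1) + 1 + finrank ℂ ↥(LinearMap.ker (Matrix.toLin' (Mod4.hankelT n q) + q n • LinearMap.id)) =
      (n + 3) * (n + n).choose n := by
  haveI : Module.Finite ℂ (complexBetti A.X 1) := abelianVarietyCohomologyExteriorH1_holds.finite_one A
  have h := finrank_S_weilType_middle hA hdim hd hφ hP hQ hp hh h11 hvol hcP hcP0 hcQ hcQ0 hn q ht
  rw [Mod4.hankel1_rank_idealShape_of_det_ne_zero n q hHsq hH,
    Mod4.finrank_ker_middleM_idealShape_pin_zero_of_det_eq_zero hn heven hq hq0 hqn hpin hB hdet] at h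
  have e : (n + 1 + 2) * (n + n).choose n = (n + 3) * (n + n).choose n := by ring
  omega

/-- **`I_Z` row, extreme pin, regular Hankel square, GENERIC `O_Z` tail** (`det Hsq ≠ 0`, `det B_0 ≠ 0`):
`dim S_n(x) + 2(n+1) + dim ker(T_f + q_n) = (n+3)·C(2n,n)` — the generic `O_Z` value when the second bit is off. [cite: BuchweitzFlenner2008HH, Prop. 6.4.4]
[cite: vanGeemen1994HodgeAV, 4.9 and Lemma 5.2] -/
theorem finrank_S_idealShape_middle_pinZero_of_det_ne_zero (hA : IsSmoothProjective A.dim A.X) {n d : ℕ} (hn : 1 ≤ n) (heven : Even n)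
    (hdim : A.dim = n + n) (hd : 0 < d)
    {φ : A ⟶ A} (hφ : φ ≫ φ = -(d • 𝟙 A)) {P Q : Submodule ℂ (complexBetti A.X 1)}
    (hP : P = Module.End.eigenspace (complexBetti.map φ.hom.hom.hom 1).hom (Complex.I * (Real.sqrt d : ℂ)))
    (hQ : Q = Module.End.eigenspace (complexBetti.map φ.hom.hom.hom 1).hom (-(Complex.I * (Real.sqrt d : ℂ))))
    (hp : finrank ℂ ↥(P ⊓ hodgeOneZero hA) = n) {h : complexBetti A.X 2}
    (hh : complexBetti.map φ.hom.hom.hom 2 h = (d : ℂ) • h) (h11 : IsOfHodgeType A.dim A.X 2 1 1 h)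
    (hvol : ((⋀[ℂ]^2 (complexBetti A.X 1)).subtype ((abelianVarietyCohomologyExteriorH1_holds.equiv A 2).symm h)) ^ (n + n) ≠ 0)
    {cP cQ : complexBetti A.X (2 * n)} (hcP : cP ∈ weilClassesPlus A φ n d) (hcP0 : cP ≠ 0)
    (hcQ : cQ ∈ weilClassesMinus A φ n d) (hcQ0 : cQ ≠ 0)
    {q : ℕ → ℂ} (hq : ∀ m, 1 ≤ m → m < n → q m = 0) (hq0 : q 0 ≠ 0) (hqn : q n ≠ 0) {t : ℂ}
    (ht : (((n + n).factorial : ℕ) : ℂ) •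
        ((⋀[ℂ]^(2 * n) (complexBetti A.X 1)).subtype ((abelianVarietyCohomologyExteriorH1_holds.equiv A (2 * n)).symm cP) *
          (⋀[ℂ]^(2 * n) (complexBetti A.X 1)).subtype ((abelianVarietyCohomologyExteriorH1_holds.equiv A (2 * n)).symm cQ)) =
      t • ((⋀[ℂ]^2 (complexBetti A.X 1)).subtype ((abelianVarietyCohomologyExteriorH1_holds.equiv A 2).symm h)) ^ (n + n))
    (hpin : t = q n * q n) {B : Matrix (Fin n) (Fin n) ℂ}
    (hB : B = Matrix.of fun r s : Fin n =>
      (Mod4.hankelT n (Function.update q 0 0) - q n • (1 : Matrix (Fin (n + 1)) (Fin (n + 1)) ℂ)) ⟨0 + r, by omega⟩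
        ⟨0 + 1 + s, by omega⟩)
    {Hsq : Matrix (Fin (n + 1)) (Fin (n + 1)) ℂ} (hHsq : Hsq = Matrix.of fun i j : Fin (n + 1) => q ((i : ℕ) + (j : ℕ)))
    (hH : Hsq.det ≠ 0) (hdet : B.det ≠ 0) :
    finrank ℂ ↥(S ℂ (hodgeZeroOne hA) n
        ((∑ m ∈ Finset.range (n + n + 1), (q m * ((m.factorial : ℕ) : ℂ)⁻¹) •
            ((⋀[ℂ]^2 (complexBetti A.X 1)).subtype ((abelianVarietyCohomologyExteriorH1_holds.equiv A 2).symm h)) ^ m) +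
          (⋀[ℂ]^(2 * n) (complexBetti A.X 1)).subtype ((abelianVarietyCohomologyExteriorH1_holds.equiv A (2 * n)).symm cP) +
          (⋀[ℂ]^(2 * n) (complexBetti A.X 1)).subtype ((abelianVarietyCohomologyExteriorH1_holds.equiv A (2 * n)).symm cQ))) +
        2 * (n + 1) + finrank ℂ ↥(LinearMap.ker (Matrix.toLin' (Mod4.hankelT n q) + q n • LinearMap.id)) =
      (n + 3) * (n + n).choose n := by
  haveI : Module.Finite ℂ (complexBetti A.X 1) := abelianVarietyCohomologyExteriorH1_holds.finite_one A
  have h := finrank_S_weilType_middle hA hdim hd hφ hP hQ hp hh h11 hvol hcP hcP0 hcQ hcQ0 hn q ht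
  rw [Mod4.hankel1_rank_idealShape_of_det_ne_zero n q hHsq hH,
    Mod4.finrank_ker_middleM_idealShape_pin_zero_of_det_ne_zero hn heven hq hq0 hqn hpin hB hdet] at h
  have e : (n + 1 + 2) * (n + n).choose n = (n + 3) * (n + n).choose n := by ring
  omega

/-- **`I_Z` row, extreme pin, DEGENERATE Hankel square, degenerate `O_Z` tail** (`det Hsq = 0`, `det B_0 = 0`):
`dim S_n(x) + 2n + 1 + dim ker(T_f + q_n) = (n+2)·C(2n,n)`. [cite: BuchweitzFlenner2008HH, Prop. 6.4.4] [cite: vanGeemen1994HodgeAV, 4.9 and Lemma 5.2] -/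
theorem finrank_S_idealShape_middle_pinZero_hankelDeg_of_det_eq_zero (hA : IsSmoothProjective A.dim A.X) {n d : ℕ} (hn : 1 ≤ n) (heven : Even n)
    (hdim : A.dim = n + n) (hd : 0 < d)
    {φ : A ⟶ A} (hφ : φ ≫ φ = -(d • 𝟙 A)) {P Q : Submodule ℂ (complexBetti A.X 1)}
    (hP : P = Module.End.eigenspace (complexBetti.map φ.hom.hom.hom 1).hom (Complex.I * (Real.sqrt d : ℂ)))
    (hQ : Q = Module.End.eigenspace (complexBetti.map φ.hom.hom.hom 1).hom (-(Complex.I * (Real.sqrt d : ℂ))))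
    (hp : finrank ℂ ↥(P ⊓ hodgeOneZero hA) = n) {h : complexBetti A.X 2}
    (hh : complexBetti.map φ.hom.hom.hom 2 h = (d : ℂ) • h) (h11 : IsOfHodgeType A.dim A.X 2 1 1 h)
    (hvol : ((⋀[ℂ]^2 (complexBetti A.X 1)).subtype ((abelianVarietyCohomologyExteriorH1_holds.equiv A 2).symm h)) ^ (n + n) ≠ 0)
    {cP cQ : complexBetti A.X (2 * n)} (hcP : cP ∈ weilClassesPlus A φ n d) (hcP0 : cP ≠ 0)
    (hcQ : cQ ∈ weilClassesMinus A φ n d) (hcQ0 : cQ ≠ 0)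
    {q : ℕ → ℂ} (hq : ∀ m, 1 ≤ m → m < n → q m = 0) (hq0 : q 0 ≠ 0) (hqn : q n ≠ 0) {t : ℂ}
    (ht : (((n + n).factorial : ℕ) : ℂ) •
        ((⋀[ℂ]^(2 * n) (complexBetti A.X 1)).subtype ((abelianVarietyCohomologyExteriorH1_holds.equiv A (2 * n)).symm cP) *
          (⋀[ℂ]^(2 * n) (complexBetti A.X 1)).subtype ((abelianVarietyCohomologyExteriorH1_holds.equiv A (2 * n)).symm cQ)) =
      t • ((⋀[ℂ]^2 (complexBetti A.X 1)).subtype ((abelianVarietyCohomologyExteriorH1_holds.equiv A 2).symm h)) ^ (n + n))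
    (hpin : t = q n * q n) {B : Matrix (Fin n) (Fin n) ℂ}
    (hB : B = Matrix.of fun r s : Fin n =>
      (Mod4.hankelT n (Function.update q 0 0) - q n • (1 : Matrix (Fin (n + 1)) (Fin (n + 1)) ℂ)) ⟨0 + r, by omega⟩
        ⟨0 + 1 + s, by omega⟩)
    {Hsq : Matrix (Fin (n + 1)) (Fin (n + 1)) ℂ} (hHsq : Hsq = Matrix.of fun i j : Fin (n + 1) => q ((i : ℕ) + (j : ℕ)))
    (hH : Hsq.det = 0) (hdet : B.det = 0) :
    finrank ℂ ↥(S ℂ (hodgeZeroOne hA) n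
        ((∑ m ∈ Finset.range (n + n + 1), (q m * ((m.factorial : ℕ) : ℂ)⁻¹) •
            ((⋀[ℂ]^2 (complexBetti A.X 1)).subtype ((abelianVarietyCohomologyExteriorH1_holds.equiv A 2).symm h)) ^ m) +
          (⋀[ℂ]^(2 * n) (complexBetti A.X 1)).subtype ((abelianVarietyCohomologyExteriorH1_holds.equiv A (2 * n)).symm cP) +
          (⋀[ℂ]^(2 * n) (complexBetti A.X 1)).subtype ((abelianVarietyCohomologyExteriorH1_holds.equiv A (2 * n)).symm cQ))) +
        2 * n + 1 + finrank ℂ ↥(LinearMap.ker (Matrix.toLin' (Mod4.hankelT n q) + q n • LinearMap.id)) =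
      (n + 2) * (n + n).choose n := by
  haveI : Module.Finite ℂ (complexBetti A.X 1) := abelianVarietyCohomologyExteriorH1_holds.finite_one A
  have h := finrank_S_weilType_middle hA hdim hd hφ hP hQ hp hh h11 hvol hcP hcP0 hcQ hcQ0 hn q ht
  rw [Mod4.hankel1_rank_idealShape_of_det_eq_zero hq hqn hHsq hH,
    Mod4.finrank_ker_middleM_idealShape_pin_zero_of_det_eq_zero hn heven hq hq0 hqn hpin hB hdet] at h
  omega

/-- **`I_Z` row, extreme pin, DEGENERATE Hankel square, generic `O_Z` tail** (`det Hsq = 0`, `det B_0 ≠ 0`):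
`dim S_n(x) + 2n + dim ker(T_f + q_n) = (n+2)·C(2n,n)`. [cite: BuchweitzFlenner2008HH, Prop. 6.4.4] [cite: vanGeemen1994HodgeAV, 4.9 and Lemma 5.2] -/
theorem finrank_S_idealShape_middle_pinZero_hankelDeg_of_det_ne_zero (hA : IsSmoothProjective A.dim A.X) {n d : ℕ} (hn : 1 ≤ n) (heven : Even n)
    (hdim : A.dim = n + n) (hd : 0 < d)
    {φ : A ⟶ A} (hφ : φ ≫ φ = -(d • 𝟙 A)) {P Q : Submodule ℂ (complexBetti A.X 1)}
    (hP : P = Module.End.eigenspace (complexBetti.map φ.hom.hom.hom 1).hom (Complex.I * (Real.sqrt d : ℂ)))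
    (hQ : Q = Module.End.eigenspace (complexBetti.map φ.hom.hom.hom 1).hom (-(Complex.I * (Real.sqrt d : ℂ))))
    (hp : finrank ℂ ↥(P ⊓ hodgeOneZero hA) = n) {h : complexBetti A.X 2}
    (hh : complexBetti.map φ.hom.hom.hom 2 h = (d : ℂ) • h) (h11 : IsOfHodgeType A.dim A.X 2 1 1 h)
    (hvol : ((⋀[ℂ]^2 (complexBetti A.X 1)).subtype ((abelianVarietyCohomologyExteriorH1_holds.equiv A 2).symm h)) ^ (n + n) ≠ 0)
    {cP cQ : complexBetti A.X (2 * n)} (hcP : cP ∈ weilClassesPlus A φ n d) (hcP0 : cP ≠ 0)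
    (hcQ : cQ ∈ weilClassesMinus A φ n d) (hcQ0 : cQ ≠ 0)
    {q : ℕ → ℂ} (hq : ∀ m, 1 ≤ m → m < n → q m = 0) (hq0 : q 0 ≠ 0) (hqn : q n ≠ 0) {t : ℂ}
    (ht : (((n + n).factorial : ℕ) : ℂ) •
        ((⋀[ℂ]^(2 * n) (complexBetti A.X 1)).subtype ((abelianVarietyCohomologyExteriorH1_holds.equiv A (2 * n)).symm cP) *
          (⋀[ℂ]^(2 * n) (complexBetti A.X 1)).subtype ((abelianVarietyCohomologyExteriorH1_holds.equiv A (2 * n)).symm cQ)) =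
      t • ((⋀[ℂ]^2 (complexBetti A.X 1)).subtype ((abelianVarietyCohomologyExteriorH1_holds.equiv A 2).symm h)) ^ (n + n))
    (hpin : t = q n * q n) {B : Matrix (Fin n) (Fin n) ℂ}
    (hB : B = Matrix.of fun r s : Fin n =>
      (Mod4.hankelT n (Function.update q 0 0) - q n • (1 : Matrix (Fin (n + 1)) (Fin (n + 1)) ℂ)) ⟨0 + r, by omega⟩
        ⟨0 + 1 + s, by omega⟩)
    {Hsq : Matrix (Fin (n + 1)) (Fin (n + 1)) ℂ} (hHsq : Hsq = Matrix.of fun i j : Fin (n + 1) => q ((i : ℕ) + (j : ℕ)))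
    (hH : Hsq.det = 0) (hdet : B.det ≠ 0) :
    finrank ℂ ↥(S ℂ (hodgeZeroOne hA) n
        ((∑ m ∈ Finset.range (n + n + 1), (q m * ((m.factorial : ℕ) : ℂ)⁻¹) •
            ((⋀[ℂ]^2 (complexBetti A.X 1)).subtype ((abelianVarietyCohomologyExteriorH1_holds.equiv A 2).symm h)) ^ m) +
          (⋀[ℂ]^(2 * n) (complexBetti A.X 1)).subtype ((abelianVarietyCohomologyExteriorH1_holds.equiv A (2 * n)).symm cP) +
          (⋀[ℂ]^(2 * n) (complexBetti A.X 1)).subtype ((abelianVarietyCohomologyExteriorH1_holds.equiv A (2 * n)).symm cQ))) +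
        2 * n + finrank ℂ ↥(LinearMap.ker (Matrix.toLin' (Mod4.hankelT n q) + q n • LinearMap.id)) =
      (n + 2) * (n + n).choose n := by
  haveI : Module.Finite ℂ (complexBetti A.X 1) := abelianVarietyCohomologyExteriorH1_holds.finite_one A
  have h := finrank_S_weilType_middle hA hdim hd hφ hP hQ hp hh h11 hvol hcP hcP0 hcQ hcQ0 hn q ht
  rw [Mod4.hankel1_rank_idealShape_of_det_eq_zero hq hqn hHsq hH,
    Mod4.finrank_ker_middleM_idealShape_pin_zero_of_det_ne_zero hn heven hq hq0 hqn hpin hB hdet] at h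
  omega

end RealCarrier

end Summit.Ventures.HSemireg.WeilFrame

end
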